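import Summits.QuantumFields.BalabanUV.T4Continuum.Support.CovariantVectorCovarianceDecayChart
import Summits.QuantumFields.BalabanUV.T4Continuum.Support.DecayRateInterpolation
import Literature.MathematicalPhysics.QuantumFieldTheory.Balaban1983to89.Beta.EffectiveKernel

/-!
# T⁴ programme, SUBSTRATE (shared lattice-gauge analysis library) — THE STENCIL SEPARATION FROM THE BLOCK DISTANCE, AND THE COVARIANCE
# SPECIES' CHART DECAY IN THE `EntryDecay dist C B δ` SHAPE: `dist(b, b′) = ldist_M(y, y′)` (coarse sup-distance of the bond base points),
# `δ = κ_F = kappaF |o| d a′ γ`, `B_k = ‖s‖·16·|o|·(lev k)^{−d}·(8∕γ)·e^{2κ_F}` (typer LIBRARY L-A9b = W-9c; rulings (λ12)(ii) l.17637, (λ16) l.18017)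

Substrate cell `b2b-balaban-substrate-*`, seat p3 (gen 3).  W-9b (`CovariantVectorCovarianceDecayChart`, p228053) proves the decay of the
covariance entries `C(b, b′)` under the DISPLAYED stencil separation `hr : qr(b, i) ≠ 0 → qr(b′, i′) ≠ 0 → n·r ≤ ldist_{fine}(i₁, i′₁)`.  This
module discharges `hr` from the geometry of the two tori — the `Q`-stencil of the coarse bond `(y, μ)` is `{n·y + j + t e_μ : 0 ≤ j_ν, t < n}`, so
two stencils are at fine sup-distance `≥ n·ldist_M(y, y′) − 2(n − 1) ≥ n·(ldist_M(y, y′) − 2)` — and substitutes `r := ldist_M(y, y′) − 2`, paying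
the stencil diameter as the factor `e^{2κ_F} ≤ e²` in the constant.
 * §1 `stencil_apply_eq_natCast` (the class of a stencil coordinate), `circAbs_stencil_ge` (per coordinate:
   `n·dist(y_ν − y′_ν, M_νℤ) ≤ dist(x_ν − x′_ν, nM_νℤ) + 2(n − 1)` — `Beta.EffectiveKernel.circAbs_scale` BY NAME with the shift
   `(j_ν − j′_ν) + ([ν = μ]t − [ν = μ′]t′)`), `ldist_stencil_ge` (`n·ldist_M(y, y′) ≤ ldist_{nM}(x, x′) + 2(n − 1)`, the sup assembled as in
   `EffectiveKernel.ldist_blocks_le`), **`hr_of_blockDist`** (W-9b's `hr` with `r := ldist_M(b.1, b′.1) − 2`, via `DeltaACombesThomas.qr_ne_zero`);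
 * §2 one level: **`unitCovT_chart_entry_decay_blockDist`** (`‖A‖ < rho1`: `‖C(b, b′)‖ ≤ ‖s‖·(3 + E)²·|o|·n^{−d}·(8∕γ)·e^{−κ_F(ldist_M − 2)}`);
 * §3 tower, in `DecayRateInterpolation.EntryDecay` shape (BY NAME): **`entryDecay_unitCovT_chart_levelBall`** (on p1's cylinder
   `levelBall P k (rhoStar∕lev k)`, printed letters `cPr`∕`aPr`), `entryDecay_unitCovT_chart_tower` (`InHoloBallT`), `entryDecay_unitCovT_chart_levelFree`
   (constant `‖s‖·(16·|o|)·(8∕γ)·e²`, NO letter sees `k`), **`entryDecay_covAtTLev_chart_on_levelBall`** (the `covAtTLev` face, weights `s : ℕ → ℂ`, tag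
   `t`, `k ≤ K`), **`entryDecay_covAtTLev_chart_on_ballExplicit`** (on p1's tower ball `ball 0 rhoLev`, EVERY `k : ℕ` — levels `k > K` read `0`)
   and **`entryDecay_covAtTLev_chart_on_ballExplicit_uniform`** (bounded weights `‖s k‖ ≤ S`: ONE constant `S·(16·|o|)·(8∕γ)·e²` and ONE rate `κ_F`
   for ALL levels — the level-UNIFORM shape, visible).
HONEST FRAMING (T4-DAG p. 1).  Block bookkeeping on finite tori + a substitution ([folklore]; constants OURS and crude: the stencil-diameter
loss stays VISIBLE as the factor `e^{2κ_F}` inside `B`); `dist` is the coarse sup-distance of the bond BASE POINTS (two bonds of one block are at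
`dist = 0`); structural lemmas of the substrate's own chart species, NOT an estimate of any NE row; nothing printed is a hypothesis.  WHAT THIS IS
NOT (ruling (λ16)(iii), verbatim): NE2's `hdec` is about `pertCovC P t k` = the King-averaged UNIT-LATTICE covariances of the perturbed FREE tower
`(Δ_a^{(k)} ⊗ 1 + tP_k)⁻¹` on `idx L M 0 × o` (`NE2ColourPerturbedLayer`; `NE2BalabanDecayRate`) — NOT the substrate's background-field `unitCovT` ∕
`covAtTLev`; W-9b ∕ W-9c prove the SAME KIND (`EntryDecay`, level-uniform) for the BACKGROUND-FIELD covariance species at MODEL level; the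
junction ∕ dictionary to `pertCovC` (sub-row Δ3's «one printed-kind uniform decay input») is the NE2 instancer's and is NOT claimed — likewise
NE4 W2's `hdec`, NE5 D-8 (vii)'s `dk`, NE9's species decay letters.  No `def`; spine 0/9 unchanged; NOT infinite volume ∕ mass gap ∕ Clay.
HONEST DEPENDENCY: continuum YM on T⁴ ⇐ BetaPertH ∧ nine spine estimates (0/9 proved); BetaPertH ⇐ (D1) ∧ (D4) ∧ CAP+tail; G-an2-4 gates asym,
D1 and NE2/3/4.  ABSOLUTE RULE kept; no `sorry`.
-/

noncomputable section

open scoped BigOperators ComplexConjugate Matrix Matrix.Norms.L2Operator Kronecker ComplexOrder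

namespace Summit.QuantumFields.BalabanUV.T4Continuum.CovariantVectorCovarianceDecayBlocks

open Literature.MathematicalPhysics.QuantumFieldTheory.Balaban1983to89.B5Prop11Plancherel (Tor fine)
open Literature.MathematicalPhysics.QuantumFieldTheory.Balaban1983to89.B5Block118 (bpt tstep)
open Literature.MathematicalPhysics.QuantumFieldTheory.Balaban1983to89.B5Blocks16 (bpt_eq_natCast)
open Literature.MathematicalPhysics.QuantumFieldTheory.Balaban1983to89.Beta.DeltaACombesThomas (qr qr_ne_zero)
open Literature.MathematicalPhysics.QuantumFieldTheory.Balaban1983to89.Beta.TorusG0Decay (ldist toSite one_le circAbs_congr ldist_le_of_forall)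
open Literature.MathematicalPhysics.QuantumFieldTheory.Balaban1983to89.Beta.EffectiveKernel (circAbs_scale)
open Literature.MathematicalPhysics.QuantumFieldTheory.Balaban1983to89.B4TorusKernel.MultiPeriod (circAbs)
open Literature.MathematicalPhysics.QuantumFieldTheory.Balaban1983to89.B4Sect5Torus (circAbs_le_tdist tdist_nonneg)
open Summit.QuantumFields.BalabanUV.T4Continuum
open Summit.QuantumFields.BalabanUV.T4Continuum.CovariantBlockAveraging (ContourSystem)
open Summit.QuantumFields.BalabanUV.T4Continuum.CoerciveInverseTower (Coercive)
open Summit.QuantumFields.BalabanUV.T4Continuum.SubstrateTransporterSpecies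
open Summit.QuantumFields.BalabanUV.T4Continuum.CovariantVectorCoercive (vecOp)
open Summit.QuantumFields.BalabanUV.T4Continuum.CovariantVectorCoerciveHolo (InHoloBallT inHoloBallT_apply)
open Summit.QuantumFields.BalabanUV.T4Continuum.CovariantVectorChartFactorisation (Etr)
open Summit.QuantumFields.BalabanUV.T4Continuum.CovariantVectorCoerciveHoloForm (rho1 rhoStar)
open Summit.QuantumFields.BalabanUV.T4Continuum.CovariantVectorGreenDecayChartExplicit (kappaF kappaF_pos_le_one)
open Summit.QuantumFields.BalabanUV.T4Continuum.DecayRateInterpolation (EntryDecay EntryDecay.mono)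
open Summit.QuantumFields.BalabanUV.T4Continuum.CovariantVectorCovarianceDecayChart

variable {d : ℕ} {o : Type*} [Fintype o] [DecidableEq o] [Nonempty o]

/-! ## §1 Geometry: the stencil separation from the block distance -/

section Geometry

variable (n : ℕ) [NeZero n] (M : Fin d → ℕ) [hM : ∀ μ, NeZero (M μ)]

omit [NeZero n] in
/-- the class of a stencil site coordinate: `(n·y + j + t e_μ)_ν = [n·v(y_ν) + j_ν + [ν = μ]·t]`. [folklore] -/
theorem stencil_apply_eq_natCast (y : Tor M) (j : Fin d → Fin n) (μ : Fin d) (t : Fin n) (ν : Fin d) :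
    (bpt n M y j + tstep (fine n M) μ t) ν
      = (((n * (y ν).val + (j ν : ℕ) + (if ν = μ then (t : ℕ) else 0) : ℕ) : ℤ) : ZMod (fine n M ν)) := by
  rw [Pi.add_apply, bpt_eq_natCast, tstep]
  split_ifs <;> push_cast <;> ring

/-- **PER COORDINATE**: `n·dist(y_ν − y′_ν, M_νℤ) ≤ dist(x_ν − x′_ν, nM_νℤ) + 2(n − 1)` for stencil sites `x = n·y + j + t e_μ`,
`x′ = n·y′ + j′ + t′ e_μ′` (`EffectiveKernel.circAbs_scale` with the shift `(j_ν − j′_ν) + ([ν=μ]t − [ν=μ′]t′)`, `|shift| ≤ 2(n−1)`). [folklore] -/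
theorem circAbs_stencil_ge (y y' : Tor M) (j j' : Fin d → Fin n) (μ μ' : Fin d) (t t' : Fin n) (ν : Fin d) :
    (n : ℤ) * circAbs (M ν) (((y ν).val : ℤ) - ((y' ν).val : ℤ))
      ≤ circAbs (fine n M ν) ((((bpt n M y j + tstep (fine n M) μ t) ν).val : ℤ)
          - (((bpt n M y' j' + tstep (fine n M) μ' t') ν).val : ℤ)) + 2 * ((n : ℤ) - 1) := by
  have hn : 1 ≤ n := Nat.one_le_iff_ne_zero.mpr (NeZero.ne n)
  set e : ℤ := (((j ν : ℕ) : ℤ) + ((if ν = μ then (t : ℕ) else 0 : ℕ) : ℤ))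
    - (((j' ν : ℕ) : ℤ) + ((if ν = μ' then (t' : ℕ) else 0 : ℕ) : ℤ)) with he
  have he2 : |e| ≤ 2 * ((n : ℤ) - 1) := by
    have hj := (j ν).is_lt
    have hj' := (j' ν).is_lt
    have ht := t.is_lt
    have ht' := t'.is_lt
    rw [he, abs_le]
    constructor <;> split_ifs <;> push_cast <;> omega
  have key : (n : ℤ) * circAbs (M ν) (((y ν).val : ℤ) - ((y' ν).val : ℤ))
      ≤ circAbs (fine n M ν) ((n : ℤ) * (((y ν).val : ℤ) - ((y' ν).val : ℤ)) + e) + |e| :=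
    circAbs_scale (one_le M ν) hn _ e
  have hcong : circAbs (fine n M ν) ((n : ℤ) * (((y ν).val : ℤ) - ((y' ν).val : ℤ)) + e)
      = circAbs (fine n M ν) ((((bpt n M y j + tstep (fine n M) μ t) ν).val : ℤ)
          - (((bpt n M y' j' + tstep (fine n M) μ' t') ν).val : ℤ)) := by
    apply circAbs_congr
    rw [Int.cast_sub, Int.cast_natCast, Int.cast_natCast, ZMod.natCast_zmod_val, ZMod.natCast_zmod_val,
      stencil_apply_eq_natCast, stencil_apply_eq_natCast, he]
    push_cast
    ring
  rw [hcong] at key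
  linarith

/-- **FINE VERSUS COARSE SUP-DISTANCE FOR STENCIL SITES**: `n·ldist_M(y, y′) ≤ ldist_{nM}(x, x′) + 2(n − 1)`. [folklore] -/
theorem ldist_stencil_ge (y y' : Tor M) (j j' : Fin d → Fin n) (μ μ' : Fin d) (t t' : Fin n) :
    (n : ℝ) * ldist M y y'
      ≤ ldist (fine n M) (bpt n M y j + tstep (fine n M) μ t) (bpt n M y' j' + tstep (fine n M) μ' t') + 2 * ((n : ℝ) - 1) := by
  set x := bpt n M y j + tstep (fine n M) μ t with hx
  set x' := bpt n M y' j' + tstep (fine n M) μ' t' with hx'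
  have hn : 1 ≤ n := Nat.one_le_iff_ne_zero.mpr (NeZero.ne n)
  have hn0 : (0 : ℝ) < n := by exact_mod_cast hn
  have hL0 : 0 ≤ ldist (fine n M) x x' := tdist_nonneg _ _ _
  set L : ℝ := (ldist (fine n M) x x' + 2 * ((n : ℝ) - 1)) / n with hL
  have hn1 : (1 : ℝ) ≤ n := by exact_mod_cast hn
  have h2n : (0 : ℝ) ≤ 2 * ((n : ℝ) - 1) := by linarith
  have hLn : 0 ≤ L := by positivity
  -- per coordinate
  have hcoord : ∀ i, (circAbs (M i) (((y i).val : ℤ) - ((y' i).val : ℤ)) : ℝ) ≤ L := by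
    intro i
    have h1 := circAbs_stencil_ge n M y y' j j' μ μ' t t' i
    have h2 : (circAbs (fine n M i) (((x i).val : ℤ) - ((x' i).val : ℤ)) : ℝ) ≤ ldist (fine n M) x x' :=
      circAbs_le_tdist (one_le (fine n M)) (toSite (fine n M) x) (toSite (fine n M) x') i
    have h1' : (n : ℝ) * (circAbs (M i) (((y i).val : ℤ) - ((y' i).val : ℤ)) : ℝ)
        ≤ (circAbs (fine n M i) (((x i).val : ℤ) - ((x' i).val : ℤ)) : ℝ) + 2 * ((n : ℝ) - 1) := by
      have := (Int.cast_le (R := ℝ)).mpr h1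
      push_cast at this
      exact this
    rw [hL, le_div_iff₀ hn0]
    linarith
  have hnat : ∀ i, circAbs (M i) (((y i).val : ℤ) - ((y' i).val : ℤ)) ≤ (⌊L⌋₊ : ℕ) := by
    intro i
    have h1 : circAbs (M i) (((y i).val : ℤ) - ((y' i).val : ℤ)) ≤ ⌊L⌋ := Int.le_floor.mpr (hcoord i)
    rwa [← Int.natCast_floor_eq_floor hLn] at h1
  have hld : ldist M y y' ≤ L := (ldist_le_of_forall M hnat).trans (Nat.floor_le hLn)
  rw [hL, le_div_iff₀ hn0] at hld
  linarith

/-- **THE STENCIL SEPARATION FROM THE BLOCK DISTANCE** (`hr_of_blockDist`): sites of the `Q`-stencils of the coarse bonds `b = (y, μ)`, `b′ = (y′, μ′)`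
are at fine sup-distance `≥ n·(ldist_M(y, y′) − 2)` — the displayed `hr` of `CovariantVectorCovarianceDecayChart` with `r := ldist M y y′ − 2`. [folklore] -/
theorem hr_of_blockDist (b b' : Tor M × Fin d) (i i' : Tor (fine n M) × Fin d) (hi : qr n M b i ≠ 0) (hi' : qr n M b' i' ≠ 0) :
    (n : ℝ) * (ldist M b.1 b'.1 - 2) ≤ ldist (fine n M) i.1 i'.1 := by
  obtain ⟨j, t, rfl⟩ := qr_ne_zero n M b i hi
  obtain ⟨j', t', rfl⟩ := qr_ne_zero n M b' i' hi'
  have h := ldist_stencil_ge n M b.1 b'.1 j j' b.2 b'.2 t t'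
  have e : (n : ℝ) * (ldist M b.1 b'.1 - 2) = n * ldist M b.1 b'.1 - 2 * ((n : ℝ) - 1) - 2 := by ring
  rw [e]
  linarith

end Geometry

/-! ## §2 One level: the covariance entry decay against the block distance -/

section OneLevel

variable (n : ℕ) [NeZero n] (M : Fin d → ℕ) [hM : ∀ μ, NeZero (M μ)]
variable {R₀ : Fin d → (Tor (fine n M) × Fin d → Matrix o o ℂ)} {Γ : ContourSystem d n M} {ℓ : ℕ} {a' γ : ℝ}

/-- **ENTRY DECAY AGAINST THE BLOCK DISTANCE, ONE LEVEL** (`‖A‖ < rho1`; W-9b `unitCovT_chart_entry_decay_explicit` with `hr := hr_of_blockDist`):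
`‖C(e^{A}R⁰, (R⁰)⁻¹e^{−A})(b, b′)‖ ≤ ‖s‖·(3 + E)²·|o|·n^{−d}·(8∕γ)·e^{−κ_F·(ldist_M(b₁₁, b′₁₁) − 2)}`. [folklore] -/
theorem unitCovT_chart_entry_decay_blockDist (hR₀ : ∀ ν i, R₀ ν i ∈ Matrix.unitaryGroup o ℂ) (hΓ : ∀ y j μ (t : Fin n), (Γ y j μ t).length ≤ ℓ)
    (ha' : 0 ≤ a') (hco : Coercive γ (vecOp n M a' Γ R₀)) (hγ : 0 < γ) (h2 : ∀ μ, 2 ≤ fine n M μ)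
    {A : Fin d → (Tor (fine n M) × Fin d → Matrix o o ℂ)} (hA : ‖A‖ < rho1 n d a' (Fintype.card o) ℓ γ) (s : ℂ) (b b' : (Tor M × Fin d) × o) :
    ‖unitCovT n M ((n : ℕ) : ℂ) (a' * (n : ℝ) ^ d) s Γ (expChart R₀ A) (expChartInv R₀ A) b b'‖
      ≤ ‖s‖ * ((3 + Etr (‖A‖ * Real.exp ‖A‖) ℓ) ^ 2 * Fintype.card o * ((n : ℝ) ^ d)⁻¹)
          * (8 / γ * Real.exp (-(kappaF (Fintype.card o) d a' γ * (ldist M b.1.1 b'.1.1 - 2)))) :=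
  unitCovT_chart_entry_decay_explicit n M hR₀ hΓ ha' hco hγ h2 hA s b b' (fun i i' hi hi' => hr_of_blockDist n M b.1 b'.1 i i' hi hi')

end OneLevel

/-! ## §3 The tower, in the `EntryDecay dist C B δ` shape -/

section Tower

open Literature.MathematicalPhysics.QuantumFieldTheory.Balaban1983to89 (Params)
open Summit.QuantumFields.BalabanUV.T4Continuum.SubstrateBackgroundTransporters (unitMod)
open Literature.MathematicalPhysics.QuantumFieldTheory.Balaban1983to89.B5G183RateUnitTower (lev lev_neZero)
open Summit.QuantumFields.BalabanUV.T4Continuum.SubstrateTransporterSpeciesHolo (expChartT expChartInvT)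
open Summit.QuantumFields.BalabanUV.T4Continuum.SubstrateTransporterSpeciesLev (cPr aPr covAtTLev)
open Summit.QuantumFields.BalabanUV.T4Continuum.SubstrateTransporterSpeciesLevExplicit (levelBall rhoLev ball_rhoLev_subset_levelBall)

variable (P : Params) (Γ : (k : ℕ) → ContourSystem P.d (lev P.L k) (unitMod P)) {R₀ : TowerData P o}

/-- **THE COVARIANCE SPECIES HAS `EntryDecay` ON THE CYLINDER** `levelBall P k (rhoStar∕lev k)` (printed letters `cPr P k`, `aPr P a′ k`):
`EntryDecay (fun b b′ ↦ ldist_M(b₁₁, b′₁₁)) C_k (‖s‖·(16·|o|·((lev k)^d)⁻¹)·(8∕γ)·e^{2κ_F}) κ_F`, `κ_F = kappaF |o| d a′ γ` LEVEL-FREE. [folklore] -/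
theorem entryDecay_unitCovT_chart_levelBall (k : Fin (P.K + 1)) {ℓ : ℕ} (hΓ : ∀ y j μ (t : Fin (lev P.L k)), (Γ k y j μ t).length ≤ ℓ)
    (hℓ : (ℓ : ℝ) ≤ ((P.d : ℝ) + 1) * (lev P.L k : ℕ)) (hR₀ : ∀ ν i, R₀ k ν i ∈ Matrix.unitaryGroup o ℂ) {a' γ : ℝ} (ha' : 0 ≤ a')
    (hco : Coercive γ (vecOp (lev P.L k) (unitMod P) a' (Γ k) (R₀ k))) (hγ : 0 < γ) (h2 : ∀ μ, 2 ≤ fine (lev P.L k) (unitMod P) μ)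
    {A : TowerData P o} (hA : A ∈ levelBall P k (rhoStar γ P.d a' (Fintype.card o) / (lev P.L k : ℕ))) (s : ℂ) :
    EntryDecay (fun b b' : (Tor (unitMod P) × Fin P.d) × o => ldist (unitMod P) b.1.1 b'.1.1)
      (unitCovT (lev P.L k) (unitMod P) (cPr P k) (aPr P a' k) s (Γ k) (expChartT P R₀ A k) (expChartInvT P R₀ A k))
      (‖s‖ * (16 * Fintype.card o * (((lev P.L k : ℕ) : ℝ) ^ P.d)⁻¹) * (8 / γ) * Real.exp (2 * kappaF (Fintype.card o) P.d a' γ))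
      (kappaF (Fintype.card o) P.d a' γ) := by
  intro b b'
  have h := unitCovT_chart_entry_decay_levelBall P Γ k hΓ hℓ hR₀ ha' hco hγ h2 hA s b b'
    (fun i i' hi hi' => hr_of_blockDist (lev P.L k) (unitMod P) b.1 b'.1 i i' hi hi')
  -- the substitution `r := D − 2` in the exponential: `e^{−κ(D − 2)} = e^{2κ}·e^{−κD}`
  have e : Real.exp (-(kappaF (Fintype.card o) P.d a' γ * (ldist (unitMod P) b.1.1 b'.1.1 - 2)))
      = Real.exp (2 * kappaF (Fintype.card o) P.d a' γ) * Real.exp (-(kappaF (Fintype.card o) P.d a' γ * ldist (unitMod P) b.1.1 b'.1.1)) := by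
    rw [← Real.exp_add]; congr 1; ring
  rw [e] at h
  exact h.trans (le_of_eq (by ring))

/-- **… ON THE TOWER BALL OF RECORD** `InHoloBallT P R⁰ (rhoStar∕lev k)`. [folklore] -/
theorem entryDecay_unitCovT_chart_tower (k : Fin (P.K + 1)) {ℓ : ℕ} (hΓ : ∀ y j μ (t : Fin (lev P.L k)), (Γ k y j μ t).length ≤ ℓ)
    (hℓ : (ℓ : ℝ) ≤ ((P.d : ℝ) + 1) * (lev P.L k : ℕ)) (hR₀ : ∀ ν i, R₀ k ν i ∈ Matrix.unitaryGroup o ℂ) {a' γ : ℝ} (ha' : 0 ≤ a')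
    (hco : Coercive γ (vecOp (lev P.L k) (unitMod P) a' (Γ k) (R₀ k))) (hγ : 0 < γ) (h2 : ∀ μ, 2 ≤ fine (lev P.L k) (unitMod P) μ)
    {A : TowerData P o} (hA : InHoloBallT P R₀ (rhoStar γ P.d a' (Fintype.card o) / (lev P.L k : ℕ)) A) (s : ℂ) :
    EntryDecay (fun b b' : (Tor (unitMod P) × Fin P.d) × o => ldist (unitMod P) b.1.1 b'.1.1)
      (unitCovT (lev P.L k) (unitMod P) (cPr P k) (aPr P a' k) s (Γ k) (expChartT P R₀ A k) (expChartInvT P R₀ A k))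
      (‖s‖ * (16 * Fintype.card o * (((lev P.L k : ℕ) : ℝ) ^ P.d)⁻¹) * (8 / γ) * Real.exp (2 * kappaF (Fintype.card o) P.d a' γ))
      (kappaF (Fintype.card o) P.d a' γ) :=
  entryDecay_unitCovT_chart_levelBall P Γ k hΓ hℓ hR₀ ha' hco hγ h2 (inHoloBallT_apply P hA k) s

/-- **… WITH A LEVEL-FREE CONSTANT** `‖s‖·(16·|o|)·(8∕γ)·e²` (`(lev k)^{−d} ≤ 1`, `κ_F ≤ 1`): for one weight `s`, NO letter of `(B, δ)` sees `k`. [folklore] -/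
theorem entryDecay_unitCovT_chart_levelFree (k : Fin (P.K + 1)) {ℓ : ℕ} (hΓ : ∀ y j μ (t : Fin (lev P.L k)), (Γ k y j μ t).length ≤ ℓ)
    (hℓ : (ℓ : ℝ) ≤ ((P.d : ℝ) + 1) * (lev P.L k : ℕ)) (hR₀ : ∀ ν i, R₀ k ν i ∈ Matrix.unitaryGroup o ℂ) {a' γ : ℝ} (ha' : 0 ≤ a')
    (hco : Coercive γ (vecOp (lev P.L k) (unitMod P) a' (Γ k) (R₀ k))) (hγ : 0 < γ) (h2 : ∀ μ, 2 ≤ fine (lev P.L k) (unitMod P) μ)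
    {A : TowerData P o} (hA : A ∈ levelBall P k (rhoStar γ P.d a' (Fintype.card o) / (lev P.L k : ℕ))) (s : ℂ) :
    EntryDecay (fun b b' : (Tor (unitMod P) × Fin P.d) × o => ldist (unitMod P) b.1.1 b'.1.1)
      (unitCovT (lev P.L k) (unitMod P) (cPr P k) (aPr P a' k) s (Γ k) (expChartT P R₀ A k) (expChartInvT P R₀ A k))
      (‖s‖ * (16 * Fintype.card o) * (8 / γ) * Real.exp 2) (kappaF (Fintype.card o) P.d a' γ) := by
  refine (entryDecay_unitCovT_chart_levelBall P Γ k hΓ hℓ hR₀ ha' hco hγ h2 hA s).mono ?_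
  have hk := kappaF_pos_le_one (Fintype.card o) P.d ha' hγ
  have h1 : (1 : ℝ) ≤ ((lev P.L k : ℕ) : ℝ) ^ P.d := one_le_pow₀ (by exact_mod_cast Nat.pos_of_ne_zero (NeZero.ne _))
  have hlev : 16 * (Fintype.card o : ℝ) * (((lev P.L k : ℕ) : ℝ) ^ P.d)⁻¹ ≤ 16 * Fintype.card o := by
    have h16 : (0 : ℝ) ≤ 16 * Fintype.card o := by positivity
    calc 16 * (Fintype.card o : ℝ) * (((lev P.L k : ℕ) : ℝ) ^ P.d)⁻¹ ≤ 16 * Fintype.card o * 1 :=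
          mul_le_mul_of_nonneg_left (inv_le_one_of_one_le₀ h1) h16
      _ = 16 * Fintype.card o := mul_one _
  have hexp : Real.exp (2 * kappaF (Fintype.card o) P.d a' γ) ≤ Real.exp 2 := Real.exp_le_exp.mpr (by linarith [hk.2])
  have hγ8 : 0 ≤ 8 / γ := by positivity
  exact mul_le_mul (mul_le_mul_of_nonneg_right (mul_le_mul_of_nonneg_left hlev (norm_nonneg _)) hγ8) hexp (Real.exp_pos _).le
    (by positivity)

/-- **THE `covAtTLev` FACE ON THE CYLINDER** (weights `s : ℕ → ℂ`, letter families `cPr P` ∕ `aPr P a′`, any tag `t`, level `k ≤ K`): the level-`k`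
covariance read through `covAtTLev`, as a matrix on `(Tor (unitMod P) × Fin d) × o`, has `EntryDecay dist · (‖s k‖·16|o|(lev k)^{−d}·(8∕γ)·e^{2κ_F}) κ_F`
against the coarse sup-distance of the bond base points. [folklore] -/
theorem entryDecay_covAtTLev_chart_on_levelBall (s : ℕ → ℂ) (k : Fin (P.K + 1)) {ℓ : ℕ}
    (hΓ : ∀ y j μ (t : Fin (lev P.L k)), (Γ k y j μ t).length ≤ ℓ) (hℓ : (ℓ : ℝ) ≤ ((P.d : ℝ) + 1) * (lev P.L k : ℕ))
    (hR₀ : ∀ ν i, R₀ k ν i ∈ Matrix.unitaryGroup o ℂ) {a' γ : ℝ} (ha' : 0 ≤ a') (hco : Coercive γ (vecOp (lev P.L k) (unitMod P) a' (Γ k) (R₀ k)))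
    (hγ : 0 < γ) (h2 : ∀ μ, 2 ≤ fine (lev P.L k) (unitMod P) μ) {A : TowerData P o}
    (hA : A ∈ levelBall P k (rhoStar γ P.d a' (Fintype.card o) / (lev P.L k : ℕ))) {T : Type*} (t : T) :
    EntryDecay (fun b b' : (Tor (unitMod P) × Fin P.d) × o => ldist (unitMod P) b.1.1 b'.1.1)
      (fun b b' => covAtTLev P (cPr P) (aPr P a') Γ s (expChartT P R₀ A) (expChartInvT P R₀ A) k t b b')
      (‖s k‖ * (16 * Fintype.card o * (((lev P.L k : ℕ) : ℝ) ^ P.d)⁻¹) * (8 / γ) * Real.exp (2 * kappaF (Fintype.card o) P.d a' γ))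
      (kappaF (Fintype.card o) P.d a' γ) := by
  intro b b'
  show ‖covAtTLev P (cPr P) (aPr P a') Γ s (expChartT P R₀ A) (expChartInvT P R₀ A) k t b b'‖ ≤ _
  unfold covAtTLev covAtT
  simp only [dif_pos (Nat.le_of_lt_succ k.2), Fin.eta]
  exact entryDecay_unitCovT_chart_levelBall P Γ k hΓ hℓ hR₀ ha' hco hγ h2 hA (s k) b b'

variable (hR₀ : ∀ (k : Fin (P.K + 1)) ν i, R₀ k ν i ∈ Matrix.unitaryGroup o ℂ) {a' γ : ℝ} (ha' : 0 ≤ a')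
  (hco : ∀ k : Fin (P.K + 1), Coercive γ (vecOp (lev P.L k) (unitMod P) a' (Γ k) (R₀ k))) (hγ : 0 < γ)
  {ℓ : Fin (P.K + 1) → ℕ} (hΓ : ∀ (k : Fin (P.K + 1)) y j μ (t : Fin (lev P.L k)), (Γ k y j μ t).length ≤ ℓ k)
  (hℓ : ∀ k : Fin (P.K + 1), (ℓ k : ℝ) ≤ ((P.d : ℝ) + 1) * (lev P.L k : ℕ)) (h2 : ∀ (k : Fin (P.K + 1)) μ, 2 ≤ fine (lev P.L k) (unitMod P) μ)

include hR₀ ha' hco hγ hΓ hℓ h2 in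
/-- **THE `covAtTLev` FACE ON THE TOWER BALL `ball 0 rhoLev`, EVERY LEVEL `k : ℕ`** (W-15's hypothesis package; p224945
`ball_rhoLev_subset_levelBall`; levels `k > K` read `0`): `EntryDecay dist (covAtTLev … k t) (‖s k‖·16|o|(lev k)^{−d}·(8∕γ)·e^{2κ_F}) κ_F`. [folklore] -/
theorem entryDecay_covAtTLev_chart_on_ballExplicit (s : ℕ → ℂ) (k : ℕ) {T : Type*} (t : T) {A : TowerData P o}
    (hA : A ∈ Metric.ball (0 : TowerData P o) (rhoLev P (o := o) γ a')) :
    EntryDecay (fun b b' : (Tor (unitMod P) × Fin P.d) × o => ldist (unitMod P) b.1.1 b'.1.1)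
      (fun b b' => covAtTLev P (cPr P) (aPr P a') Γ s (expChartT P R₀ A) (expChartInvT P R₀ A) k t b b')
      (‖s k‖ * (16 * Fintype.card o * (((lev P.L k : ℕ) : ℝ) ^ P.d)⁻¹) * (8 / γ) * Real.exp (2 * kappaF (Fintype.card o) P.d a' γ))
      (kappaF (Fintype.card o) P.d a' γ) := by
  by_cases hk : k ≤ P.K
  · have h := entryDecay_covAtTLev_chart_on_levelBall P Γ s ⟨k, Nat.lt_succ_of_le hk⟩ (hΓ _) (hℓ _) (hR₀ _) ha' (hco _) hγ (h2 _)
      (ball_rhoLev_subset_levelBall P ha' hγ _ hA) t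
    exact h
  · intro b b'
    show ‖covAtTLev P (cPr P) (aPr P a') Γ s (expChartT P R₀ A) (expChartInvT P R₀ A) k t b b'‖ ≤ _
    unfold covAtTLev covAtT
    simp only [dif_neg hk, norm_zero]
    positivity

include hR₀ ha' hco hγ hΓ hℓ h2 in
/-- **ONE `(B, δ)` FOR ALL LEVELS** (bounded weights `‖s k‖ ≤ S`; `(lev k)^{−d} ≤ 1`, `κ_F ≤ 1`): on `ball 0 rhoLev`, for EVERY `k : ℕ`,
`EntryDecay dist (covAtTLev … k t) (S·(16·|o|)·(8∕γ)·e²) κ_F` — the level-UNIFORM shape the rows display (one constant, one rate, all levels),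
here for the BACKGROUND-FIELD covariance species at MODEL level (see the header for what this is NOT). [folklore] -/
theorem entryDecay_covAtTLev_chart_on_ballExplicit_uniform (s : ℕ → ℂ) {S : ℝ} (hs : ∀ k, ‖s k‖ ≤ S) (k : ℕ) {T : Type*} (t : T)
    {A : TowerData P o} (hA : A ∈ Metric.ball (0 : TowerData P o) (rhoLev P (o := o) γ a')) :
    EntryDecay (fun b b' : (Tor (unitMod P) × Fin P.d) × o => ldist (unitMod P) b.1.1 b'.1.1)
      (fun b b' => covAtTLev P (cPr P) (aPr P a') Γ s (expChartT P R₀ A) (expChartInvT P R₀ A) k t b b')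
      (S * (16 * Fintype.card o) * (8 / γ) * Real.exp 2) (kappaF (Fintype.card o) P.d a' γ) := by
  refine (entryDecay_covAtTLev_chart_on_ballExplicit P Γ hR₀ ha' hco hγ hΓ hℓ h2 s k t hA).mono ?_
  have hk := kappaF_pos_le_one (Fintype.card o) P.d ha' hγ
  have hS0 : 0 ≤ S := (norm_nonneg _).trans (hs 0)
  have h1 : (1 : ℝ) ≤ ((lev P.L k : ℕ) : ℝ) ^ P.d := one_le_pow₀ (by exact_mod_cast Nat.pos_of_ne_zero (NeZero.ne _))
  have h16 : (0 : ℝ) ≤ 16 * Fintype.card o := by positivity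
  have hlev : 16 * (Fintype.card o : ℝ) * (((lev P.L k : ℕ) : ℝ) ^ P.d)⁻¹ ≤ 16 * Fintype.card o := by
    calc 16 * (Fintype.card o : ℝ) * (((lev P.L k : ℕ) : ℝ) ^ P.d)⁻¹ ≤ 16 * Fintype.card o * 1 :=
          mul_le_mul_of_nonneg_left (inv_le_one_of_one_le₀ h1) h16
      _ = 16 * Fintype.card o := mul_one _
  have hexp : Real.exp (2 * kappaF (Fintype.card o) P.d a' γ) ≤ Real.exp 2 := Real.exp_le_exp.mpr (by linarith [hk.2])
  have hγ8 : 0 ≤ 8 / γ := by positivity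
  have hA' : ‖s k‖ * (16 * (Fintype.card o : ℝ) * (((lev P.L k : ℕ) : ℝ) ^ P.d)⁻¹) ≤ S * (16 * Fintype.card o) :=
    mul_le_mul (hs k) hlev (by positivity) hS0
  exact mul_le_mul (mul_le_mul_of_nonneg_right hA' hγ8) hexp (Real.exp_pos _).le (by positivity)

end Tower

end Summit.QuantumFields.BalabanUV.T4Continuum.CovariantVectorCovarianceDecayBlocks

end
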